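import Literature.Geometry.Kaehler.ComplexTorusSelfIntersectionIndex
import Literature.Geometry.Kaehler.ComplexTorusProductLineBundleH0
import Literature.Geometry.Kaehler.ComplexTorusAppellHumbertGroup
import Literature.Geometry.Kaehler.ComplexTorusEllipticCurve
import Literature.Geometry.Kaehler.ComplexTorusProductSelfIntersection
import HarnessLib

/-!
# Venture HSemireg — (S3)'s MOD-4 LAW with its (H1)-scope DISCHARGED INTO THE INDEX, at the object level, and an
# OBJECT-LEVEL WITNESS that (H1) fails at even dimension (`E_τ × E_τ'`, `η⁻ = E_τ ⊞ (−E_τ')`: index `1`,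
# `∫ η⁻ ∧ η⁻ = -2`) — TRACK S4-PUSH (ii), seat `s4-prove-1` (g8); file of record `s4push/prove-1/ATTEMPT-9.md`

HONEST FRAMING. Lean index of the computation cell `pub-hsemireg`. OBJECT LEVEL in the sense of file III
(`SecantParityObjectLevel.lean`), and only that object: the complex torus `X = E/Φ(ℤ^ι)` of the tree's Literature layer
`Literature/Geometry/Kaehler/ComplexTorus*` (lane `lit-hodgefound`), its invariant forms, `∫_X := ComplexTorus.torusIntegral`
(complex orientation), `ComplexTorus.IsNSForm`, the intrinsic index `ComplexTorus.hermIndex` of `H_η(v, w) = η(iv, w) + iη(v, w)`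
(Lange's `H`), `ComplexTorus.wedgePow`, the product torus `ComplexTorus.prodPeriod` / `prodForm` and the elliptic curve
`ℂ/(ℤτ + ℤ)` (`ellipticPeriod`, `ellipticForm`).  No sheaf, no secant plane, no Ext group, no Mukai pairing and no
semiregularity map is constructed.  The χ-IDENTITY of th-7 §D — «`(v,v)_χ = 2|xc|²(-4d)ᵐ·∫_X bⁿ/n!`» (HRR for the secant
class `v = xc·e^{a+√-d·b} + x̄c̄·e^{a-√-d·b}`, kernel at model level in `SecantParityPairing.lean`) «`= |G|·χ^G = |G|·(-2)`»
((H2) `G` acts freely + the Lemma profile `χ^G = P_n(-1) = -2`) — enters BY VALUE, as the hypothesis `hHRR` with positive reals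
`d, w, G`; that a `K`-secant SHEAF realises it is exactly the open existence clause (S4) and is NOT claimed.  Nothing here says
that HC, HC_CM or HC_AV holds; nothing here is a new case of anything; the signed words of (S3) («PROVED given `∫bⁿ > 0`»,
STRUCTURE.md v1.0 §2; STATUS WORD s4-ref P-2) do not move.  NO definition, NO named fact: theorems only, all PROVED (0 sorry),
standard axioms.  File III (`SecantParityObjectLevel.lean`) is CITED, not imported (its two small lemmas used here are re-derived inline
from the same Literature theorem), so that this leaf's import closure is the Literature layer alone.

WHAT IS ADDED TO THE LANE'S RECORD (sheet `s4push/prove-1/STATEMENTS-S3INPUT.md`).  File III made (H1) «`∫_X bⁿ > 0` ⟺ index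
even (n even)» a theorem about `∫_X`.  Here:
(A) the SIGNED LAW S3INP-5 («Lemma-profile `G`-objects at `n = 2m` force `m + s(b)` odd»; so far seat-derived ×2 and kernel
    at MODEL level — `SecantParitySignLaw.sign_law_of_posDef` for index `0`, `Mod4SignLawParity.signed_parity_law_index` on a
    diagonal frame) becomes a theorem about `∫_X` with the INTRINSIC index and no frame: `odd_add_hermIndex_of_chi_identity`;
(B) (S3)'s conclusion with the POLARISATION DATUM AS BINDER and (H1) discharged inside — CONDITIONAL ON THE χ-IDENTITY BY VALUE
    (= (S4)'s numerical shadow; s4-ref g14 P-1) (S4-PLAN lane (ii) row: «if landed ⇒ (S3) carries its (H1) scope as a visible binder»): `η` a Riemann form (`H_η` positive definite — Lange's definition of a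
    polarisation) ⇒ `m` odd, `n ≢ 0 (mod 4)` — `IsRiemannForm.odd_and_not_four_dvd_of_chi_identity` (and `…_neg` for the
    `c₁(L) = -E` representative); the other branch `even_and_four_dvd_of_chi_identity_of_odd_hermIndex` (odd index ⇒ `4 ∣ n`).  This is
    (S3)'s FIRST clause (Lemma-profile `G`-objects); its `n = 4` clause «none G-semiregular at all» needs the pinch (H3) and is not touched here;
(C) NON-VACUITY of (B)'s hypothesis set (referee checks A1–A6): `E_τ × E_τ'` with its product principal polarisation satisfies
    the χ-identity with `m = 1`, `w = d = 1`, `G = 4` (`chi_identity_prodForm_elliptic`; tree `∫ (E_τ ⊞ E_τ')^{∧2} = 2`);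
(D) the COUNTER-MODEL S3INP-4 («(H1) fails for odd index: `E⁴`, `∫b⁴ = -24`»; so far elementary ×2 + kernel shadows at model
    level) AT THE OBJECT LEVEL, in its smallest instance: on the abelian surface `E_τ × E_τ'` the class `η⁻ = E_τ ⊞ (−E_τ')`
    is in `NS`, non-degenerate, of index `hermIndex η⁻ = 1` (Sylvester on the diagonal basis `(1,0), (0,1)`:
    `H⁻ = diag(1/Im τ, -1/Im τ')`), and `∫_X η⁻ ∧ η⁻ = -2` (the tree's general formula `(-1)^{g+s}·g!·d₁d₂` with the Gram
    determinant `det blockdiag((0 1; -1 0), (0 -1; 1 0)) = 1 = (d₁d₂)²`) — PRESEARCH: the Literature layer had instances of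
    index `0` (Riemann forms) and `g` (`-η`, the Poincaré form) only; this is its first explicit class of intermediate index;
    and `not_chi_identity_prodForm_elliptic_neg`: no χ-identity with `d, w, G > 0` holds for `η⁻` at `n = 2` (odd index puts
    the obstruction at `n ≡ 2 (mod 4)`). The sheet's own `E⁴`, `-24` instance (odd branch inhabited at `n = 4`) is the sequel file IVb.

CONTENTS (namespace `Summit.Ventures.HSemireg.SecantParity`; `Φ : (ι → ℝ) ≃L[ℝ] E`, `η : E [⋀^Fin 2]→L[ℝ] ℝ`,
`e : Fin (2n) ≃ ι` pins `n = dim_ℂ X` and nothing else — `∫_X` does not depend on `e`, tree `torusIntegral_eq_torusIntegral`,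
s4-prove-3 g3 P-1; `0 < τ.im`, `0 < τ'.im`):
* §1 `odd_of_neg_one_pow_mul_eq_neg` — `(-1)ᵏ·P = -Q`, `P, Q > 0` ⇒ `k` odd;
* §2 `exists_isPolarizationType_of_equiv` (a type with THE `g` of `e`); **`odd_add_hermIndex_of_chi_identity`** —
  `η ∈ NS(X)` non-degenerate, `n = 2m`, `d, w, G > 0`, `(2w(-4d)ᵐ/(2m)!)·∫_X η^{∧2m} = G·(-2)` ⇒ `Odd (m + hermIndex η)`;
  **`IsRiemannForm.odd_and_not_four_dvd_of_chi_identity`** (`⇒ Odd m ∧ ¬ 4 ∣ 2m`), `…_neg` (same for `-η`),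
  `odd_add_hermIndex_of_chi_identity_smul` / `IsRiemannForm.odd_and_not_four_dvd_of_chi_identity_smul` (rational classes `c·η`, `c ≠ 0`),
  `even_and_four_dvd_of_chi_identity_of_odd_hermIndex` (`hermIndex η` odd ⇒ `Even m ∧ 4 ∣ 2m`);
* §3 `chi_identity_prodForm_elliptic` + an `example` feeding it to (B) (`Odd 1 ∧ ¬ 4 ∣ 2`);
* §4 `isNSForm_prodForm_elliptic_neg`, `hermOf_prodForm_elliptic_neg_finTwoProd` (`H⁻` diagonal `(1/Im τ, -1/Im τ')` on
  `(1,0), (0,1)`), **`hermIndex_prodForm_elliptic_neg`** (`= 1`), `nondegenerate_prodForm_elliptic_neg`,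
  `torusIntegral_wedgePow_prodForm_elliptic_neg_neg` (`< 0`), `det_latticeGram_prodForm_elliptic_neg` (`= 1`),
  **`torusIntegral_wedgePow_prodForm_elliptic_neg_eq`** (`= -2`), `abelianSurface_nsForm_hermIndex_one_torusIntegral_neg`
  (packaged: abelian ∧ NS ∧ non-degenerate ∧ index `1` ∧ `∫ = -2`), `not_chi_identity_prodForm_elliptic_neg`.

WHAT STAYS OUTSIDE THIS FILE (paper dictionary, unchanged from file III / `SecantParityPairing.lean`): (i) HRR `(v,v)_χ = ∫_X v^∨·v`
for the secant sheaf and the identification of that `∫_X` on the de Rham class `bⁿ` with `torusIntegral` of the invariant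
representative (de Rham; tree `ComplexTorusDeRham.lean`); (ii) `(v,v)_χ = |G|·χ^G` ((H2)) and the Lemma profile `χ^G = -2`;
(iii) the existence of any such sheaf ((S4)).  The file USES, never restates, the Literature theorems
`IsNSForm.torusIntegral_wedgePow_of_isPolarizationType`, `hermIndex_eq_card_of_orthogonal`, `exists_apply_ne_zero_of_orthogonal`,
`IsPolarizationType.det_latticeGram`, `latticeGram_prod`, `latticeGram_elliptic`, `torusIntegral_wedgePow_prod_elliptic`, `IsNSForm.prod`/`.neg`.

Statements and proofs: s4-prove-1 g8 (2026-08-23), seat ×1 + kernel; reads invited: s4-ref (§2b: `hHRR` = the χ-identity by value), s4-prove-3 (×2).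

## References

* [Lange2023AbelianVarietiesComplex] H. Lange, Abelian Varieties over the Complex Numbers (2023), §1.2.2 Lemma 1.2.10, §1.5.1,
  §1.6.2 (index), §1.7.1 Thm. 1.7.1, §1.7.2 Thm. 1.7.3, Lemma 1.7.4, Lemma 1.7.5 and its proof, §2.1.1 Example 2.1.3,
  §2.4.4 Cor. 2.4.24, §2.4.5 Exercise (8) — held text `book:lange1992-complex-abelian-varieties` (numbering of the 2023
  edition), as cited in the imported Literature files.
* [GohbergLancasterRodman2005] Gohberg–Lancaster–Rodman, Indefinite Linear Algebra and Applications (2005), §2.2, §2.3 Thm. 2.3.2 (Sylvester).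
* Cell records: STRUCTURE.md v1.0-SIGNED §2 (S3); theory/FORMULA-N-th7.md §D (Σ6); STATEMENTS-S3INPUT.md rows S3INP-4, -5, -7, -8, -9;
  ATTEMPT-9.md; s4-ref verdicts on file III (NO OBJECTION).
-/
noncomputable section

open scoped ComplexOrder
open Complex Module
open Literature.Geometry.Kaehler Literature.Geometry.Kaehler.ComplexTorus

namespace Summit.Ventures.HSemireg

namespace SecantParity

/-- `(-1)ᵏ · P = -Q` with `P, Q > 0` forces `k` odd. [folklore] -/
theorem odd_of_neg_one_pow_mul_eq_neg {k : ℕ} {P Q : ℝ} (hP : 0 < P) (hQ : 0 < Q)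
    (h : (-1 : ℝ) ^ k * P = -Q) : Odd k := by
  rcases Nat.even_or_odd k with hk | hk
  · rw [hk.neg_one_pow, one_mul] at h
    linarith
  · exact hk

/-! ### §2 The signed law at the object level -/

section SignedLaw

variable {ι : Type*} [Fintype ι] [DecidableEq ι] {E : Type*} [NormedAddCommGroup E] [NormedSpace ℂ E]
  (Φ : (ι → ℝ) ≃L[ℝ] E) {η : E [⋀^Fin 2]→L[ℝ] ℝ}

/-- A non-degenerate `η ∈ NS(X)` has a type `(d₁, …, d_g)` with THE `g` of any enumeration `e : Fin (2g) ≃ ι` of the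
lattice basis (`2g = rk Λ`; tree `IsNSForm.exists_isPolarizationType_of_nondegenerate` + `IsPolarizationType.card_eq`).
[cite: Lange2023AbelianVarietiesComplex, §1.5.1 (p0051–p0052)] -/
theorem exists_isPolarizationType_of_equiv (hη : IsNSForm Φ η)
    (hnd : ∀ v : E, v ≠ 0 → ∃ w : E, η ![v, w] ≠ 0) {g : ℕ} (e : Fin (2 * g) ≃ ι) :
    ∃ d : Fin g → ℕ, IsPolarizationType Φ η d := by
  obtain ⟨g', d, hd, -⟩ := hη.exists_isPolarizationType_of_nondegenerate Φ hnd
  have hcard : Fintype.card ι = 2 * g := by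
    have h := Fintype.card_congr e
    rw [Fintype.card_fin] at h
    exact h.symm
  have hg : g' = g := by
    have h' := hd.card_eq
    omega
  subst hg
  exact ⟨d, hd⟩

/-- **THE SIGNED LAW AT THE OBJECT LEVEL.** `X = E/Φ(ℤ^ι)` a complex torus of dimension `n = 2m`
(`e : Fin (2n) ≃ ι`), `η ∈ NS(X)` non-degenerate with intrinsic index `s = hermIndex η`; reals `d, w, G > 0`; and
th-7 §D's χ-identity BY VALUE, `(2w(-4d)ᵐ/n!)·∫_X η^{∧n} = G·(-2)` (left: `(v,v)_χ` of the `K`-secant class by HRR and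
the pairing algebra of `SecantParityPairing`; right: `|G|·χ^G` with the Lemma profile `χ^G = P_n(-1) = -2`).  THEN
**`m + s` is odd.**  No (H1) among the hypotheses: (H1) `∫_X η^{∧n} > 0` ⟺ `s` even (file III) has been absorbed.
[cite: Lange2023AbelianVarietiesComplex, §1.7.2 Lemma 1.7.5 and proof of Thm. 1.7.3] -/
theorem odd_add_hermIndex_of_chi_identity (hη : IsNSForm Φ η)
    (hnd : ∀ v : E, v ≠ 0 → ∃ w : E, η ![v, w] ≠ 0) {m : ℕ} (e : Fin (2 * (2 * m)) ≃ ι)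
    {d w G : ℝ} (hd : 0 < d) (hw : 0 < w) (hG : 0 < G)
    (hHRR : (2 * (w : ℂ) * (-4 * (d : ℂ)) ^ m / ((2 * m).factorial : ℂ)) *
        torusIntegral Φ e (wedgePow (ofRealForm η) (2 * m)) = (G : ℂ) * (-2)) :
    Odd (m + hermIndex η) := by
  obtain ⟨dd, hdd⟩ := exists_isPolarizationType_of_equiv Φ hη hnd e
  set N : ℕ := (2 * m).factorial * ∏ i, dd i with hN_def
  have hN : 0 < N := Nat.mul_pos (Nat.factorial_pos _) (Finset.prod_pos fun i _ ↦ hη.pos_of_isPolarizationType Φ hnd hdd i)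
  have hval : torusIntegral Φ e (wedgePow (ofRealForm η) (2 * m)) = (-1 : ℂ) ^ (2 * m + hermIndex η) * (N : ℂ) := by
    rw [hη.torusIntegral_wedgePow_of_isPolarizationType Φ hnd hdd e, hN_def]
    push_cast
    ring
  rw [hval] at hHRR
  have hreal : (2 * w * (-4 * d) ^ m / ((2 * m).factorial : ℝ)) *
      ((-1) ^ (2 * m + hermIndex η) * (N : ℝ)) = G * (-2) := by
    exact_mod_cast hHRR
  have h1 : (-4 * d : ℝ) ^ m = (-1) ^ m * (4 * d) ^ m := by
    rw [← mul_pow]; ring_nf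
  have h2 : (-1 : ℝ) ^ (2 * m + hermIndex η) = (-1) ^ hermIndex η := by
    rw [pow_add, pow_mul]; norm_num
  rw [h1, h2] at hreal
  have hfac : (0 : ℝ) < ((2 * m).factorial : ℝ) := by exact_mod_cast Nat.factorial_pos _
  have hNr : (0 : ℝ) < (N : ℝ) := by exact_mod_cast hN
  have key : (-1 : ℝ) ^ (m + hermIndex η) * (2 * w * (4 * d) ^ m * N / ((2 * m).factorial : ℝ)) =
      -(2 * G) := by
    rw [pow_add]
    linear_combination hreal
  exact odd_of_neg_one_pow_mul_eq_neg (by positivity) (by positivity) key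


/-- **(S3) WITH THE POLARISATION DATUM AS BINDER, (H1) DISCHARGED.** `η` a Riemann form of `X` (`H_η` positive
definite: Lange's definition of a polarisation; index `0`, tree `IsRiemannForm.hermIndex_eq_zero`), `dim X = n = 2m`,
and the χ-identity by value ⇒ **`m` is odd, i.e. `n ≢ 0 (mod 4)`** — the signed cell's (S3) «only for `n ≢ 0 (mod 4)`»
with no `∫_X bⁿ > 0` hypothesis left (it is a theorem here, file III) — but CONDITIONAL on the χ-identity by value `hHRR` (= (S4)'s numerical shadow).
Use the full name (dot-notation on the tree's `ComplexTorus.IsRiemannForm` does not reach this namespace).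
[cite: Lange2023AbelianVarietiesComplex, §1.7.1 Thm. 1.7.1 and §1.7.2 Thm. 1.7.3] -/
theorem IsRiemannForm.odd_and_not_four_dvd_of_chi_identity (hη : IsRiemannForm Φ η) {m : ℕ}
    (e : Fin (2 * (2 * m)) ≃ ι) {d w G : ℝ} (hd : 0 < d) (hw : 0 < w) (hG : 0 < G)
    (hHRR : (2 * (w : ℂ) * (-4 * (d : ℂ)) ^ m / ((2 * m).factorial : ℂ)) *
        torusIntegral Φ e (wedgePow (ofRealForm η) (2 * m)) = (G : ℂ) * (-2)) :
    Odd m ∧ ¬ 4 ∣ 2 * m := by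
  have h := odd_add_hermIndex_of_chi_identity Φ hη.isNSForm (hη.exists_apply_ne_zero Φ) e hd hw hG hHRR
  rw [hη.hermIndex_eq_zero Φ, add_zero] at h
  exact ⟨h, fun ⟨k, hk⟩ ↦ (Nat.not_even_iff_odd.mpr h) ⟨k, by omega⟩⟩

/-- The same for the class `-η` (the invariant representative of `c₁(L(H, χ))`, Lange's Lemma 1.7.4, tree
`isChernForm_ahMetric`; index `n`): at the even exponent `n = 2m`, `(-η)^{∧n} = η^{∧n}`, so the χ-identity for `-η`
again forces **`m` odd, `n ≢ 0 (mod 4)`** — the sign convention for `c₁` is immaterial to (S3).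
[cite: Lange2023AbelianVarietiesComplex, §1.7.2 Lemma 1.7.4 and Thm. 1.7.3] -/
theorem IsRiemannForm.odd_and_not_four_dvd_of_chi_identity_neg (hη : IsRiemannForm Φ η) {m : ℕ}
    (e : Fin (2 * (2 * m)) ≃ ι) {d w G : ℝ} (hd : 0 < d) (hw : 0 < w) (hG : 0 < G)
    (hHRR : (2 * (w : ℂ) * (-4 * (d : ℂ)) ^ m / ((2 * m).factorial : ℂ)) *
        torusIntegral Φ e (wedgePow (ofRealForm (-η)) (2 * m)) = (G : ℂ) * (-2)) :
    Odd m ∧ ¬ 4 ∣ 2 * m := by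
  have heven : Even (2 * m) := even_two_mul m
  rw [ComplexTorus.ofRealForm_neg, wedgePow_neg, heven.neg_one_pow, one_smul] at hHRR
  exact IsRiemannForm.odd_and_not_four_dvd_of_chi_identity Φ hη e hd hw hG hHRR

/-- **RATIONAL CLASSES** (the `ℚ` of `NS(X)_ℚ`: THE `b` of th-7 Σ6 is `c·η` with `η ∈ NS(X)` and `c ∈ ℚ`, `c ≠ 0` — e.g.
`b = Ξ/4` for the W5 design of the sheet's (H1) desk, `b = ±(r/2)Ξ` for every S1-normal-form design): the χ-identity for `c·η`
(`∫_X (c·η)^{∧2m} = c^{2m}·∫_X η^{∧2m}`, file III `torusIntegral_wedgePow_smul`; `c^{2m} > 0` is absorbed into `w`) again forces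
`m + hermIndex η` odd. [cite: Lange2023AbelianVarietiesComplex, §1.7.2 Lemma 1.7.5 and proof of Thm. 1.7.3] -/
theorem odd_add_hermIndex_of_chi_identity_smul (hη : IsNSForm Φ η)
    (hnd : ∀ v : E, v ≠ 0 → ∃ w : E, η ![v, w] ≠ 0) {m : ℕ} (e : Fin (2 * (2 * m)) ≃ ι)
    {c d w G : ℝ} (hc : c ≠ 0) (hd : 0 < d) (hw : 0 < w) (hG : 0 < G)
    (hHRR : (2 * (w : ℂ) * (-4 * (d : ℂ)) ^ m / ((2 * m).factorial : ℂ)) *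
        torusIntegral Φ e (wedgePow (ofRealForm (c • η)) (2 * m)) = (G : ℂ) * (-2)) :
    Odd (m + hermIndex η) := by
  rw [ComplexTorus.ofRealForm_smul, wedgePow_smul, ComplexTorus.torusIntegral_smul] at hHRR
  have hw' : 0 < w * c ^ (2 * m) := mul_pos hw ((even_two_mul m).pow_pos hc)
  refine odd_add_hermIndex_of_chi_identity Φ hη hnd e hd hw' hG ?_
  rw [← hHRR]
  push_cast
  ring

/-- **(S3) FOR A RATIONAL MULTIPLE OF A POLARISATION** (`b = c·η`, `η` a Riemann form, `c ≠ 0` real — both orientations of the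
secant plane, every S1-normal-form design): the χ-identity for `c·η` forces `m` odd, `n ≢ 0 (mod 4)`.
[cite: Lange2023AbelianVarietiesComplex, §1.7.1 Thm. 1.7.1 and §1.7.2 Thm. 1.7.3] -/
theorem IsRiemannForm.odd_and_not_four_dvd_of_chi_identity_smul (hη : IsRiemannForm Φ η) {m : ℕ}
    (e : Fin (2 * (2 * m)) ≃ ι) {c d w G : ℝ} (hc : c ≠ 0) (hd : 0 < d) (hw : 0 < w) (hG : 0 < G)
    (hHRR : (2 * (w : ℂ) * (-4 * (d : ℂ)) ^ m / ((2 * m).factorial : ℂ)) *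
        torusIntegral Φ e (wedgePow (ofRealForm (c • η)) (2 * m)) = (G : ℂ) * (-2)) :
    Odd m ∧ ¬ 4 ∣ 2 * m := by
  have h := odd_add_hermIndex_of_chi_identity_smul Φ hη.isNSForm (hη.exists_apply_ne_zero Φ) e hc hd hw hG hHRR
  rw [hη.hermIndex_eq_zero Φ, add_zero] at h
  have h' := Nat.odd_iff.mp h
  exact ⟨h, by omega⟩

/-- **THE OTHER BRANCH: ODD INDEX ⇒ `n ≡ 0 (mod 4)`.** For `η ∈ NS(X)` non-degenerate of ODD index on a torus of
dimension `n = 2m`, the χ-identity by value forces `m` even, i.e. `4 ∣ n`: for a secant exponent of odd index the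
obstruction sits at `n ≡ 2 (mod 4)` instead (sheet S3INP-5; the `E⁴`, `∫b⁴ = -24 < 0` situation of S3INP-4, where §D
gives no obstruction at `n = 4`). [cite: Lange2023AbelianVarietiesComplex, §1.7.2 Lemma 1.7.5 and proof of Thm. 1.7.3] -/
theorem even_and_four_dvd_of_chi_identity_of_odd_hermIndex (hη : IsNSForm Φ η)
    (hnd : ∀ v : E, v ≠ 0 → ∃ w : E, η ![v, w] ≠ 0) {m : ℕ} (e : Fin (2 * (2 * m)) ≃ ι)
    {d w G : ℝ} (hd : 0 < d) (hw : 0 < w) (hG : 0 < G)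
    (hHRR : (2 * (w : ℂ) * (-4 * (d : ℂ)) ^ m / ((2 * m).factorial : ℂ)) *
        torusIntegral Φ e (wedgePow (ofRealForm η) (2 * m)) = (G : ℂ) * (-2))
    (hs : Odd (hermIndex η)) : Even m ∧ 4 ∣ 2 * m := by
  have h := odd_add_hermIndex_of_chi_identity Φ hη hnd e hd hw hG hHRR
  have hm : Even m := by
    rcases Nat.even_or_odd m with hm | hm
    · exact hm
    · exact absurd h (Nat.not_odd_iff_even.mpr (hm.add_odd hs))
  obtain ⟨k, hk⟩ := hm
  exact ⟨⟨k, hk⟩, ⟨k, by omega⟩⟩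

end SignedLaw

/-! ### §3 Non-vacuity of the hypotheses of §2 (referee checks A1–A6): the abelian surface `E_τ × E_τ'` with its
product principal polarisation `E_τ ⊞ E_τ'` (`n = 2`, `m = 1`; tree `torusIntegral_wedgePow_prod_elliptic`:
`∫ (E_τ ⊞ E_τ')^{∧2} = 2`) satisfies the χ-identity with `w = d = 1`, `G = 4` (`(2·1·(-4)/2!)·2 = -8 = 4·(-2)`), and
indeed `m = 1` is odd (`n = 2 ≢ 0 (mod 4)`). -/

section NonVacuity

variable {τ τ' : ℂ} (hτ : 0 < τ.im) (hτ' : 0 < τ'.im)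

/-- The χ-identity HOLDS on `E_τ × E_τ'` for `η = E_τ ⊞ E_τ'`, `m = 1`, `w = d = 1`, `G = 4`.
[cite: Lange2023AbelianVarietiesComplex, §2.4.5 Exercise (8) and §2.1.1 Example 2.1.3] -/
theorem chi_identity_prodForm_elliptic (e : Fin (2 * (2 * 1)) ≃ Fin 2 ⊕ Fin 2) :
    (2 * ((1 : ℝ) : ℂ) * (-4 * ((1 : ℝ) : ℂ)) ^ 1 / ((2 * 1).factorial : ℂ)) *
        torusIntegral (prodPeriod (ellipticPeriod hτ.ne') (ellipticPeriod hτ'.ne')) e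
          (wedgePow (ofRealForm (prodForm (ellipticForm hτ.ne') (ellipticForm hτ'.ne'))) (2 * 1)) =
      ((4 : ℝ) : ℂ) * (-2) := by
  have h : torusIntegral (prodPeriod (ellipticPeriod hτ.ne') (ellipticPeriod hτ'.ne')) e
      (wedgePow (ofRealForm (prodForm (ellipticForm hτ.ne') (ellipticForm hτ'.ne'))) (2 * 1)) = 2 :=
    (torusIntegral_wedgePow_prod_elliptic hτ hτ' e).1
  rw [h]
  push_cast
  norm_num [Nat.factorial]

/-- … so the hypotheses of `IsRiemannForm.odd_and_not_four_dvd_of_chi_identity` are met there (tree `IsRiemannForm.prod`),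
and its conclusion reads `Odd 1 ∧ ¬ 4 ∣ 2`. [cite: Lange2023AbelianVarietiesComplex, §2.4.5 Exercise (8)] -/
example {τ τ' : ℂ} (hτ : 0 < τ.im) (hτ' : 0 < τ'.im) (e : Fin (2 * (2 * 1)) ≃ Fin 2 ⊕ Fin 2) :
    Odd 1 ∧ ¬ 4 ∣ 2 * 1 :=
  IsRiemannForm.odd_and_not_four_dvd_of_chi_identity (prodPeriod (ellipticPeriod hτ.ne') (ellipticPeriod hτ'.ne'))
    ((isRiemannForm_ellipticForm hτ).prod (isRiemannForm_ellipticForm hτ')) e one_pos one_pos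
    (by norm_num : (0 : ℝ) < 4) (chi_identity_prodForm_elliptic hτ hτ' e)

end NonVacuity

/-! ### §4 OBJECT-LEVEL WITNESS THAT (H1) FAILS AT EVEN DIMENSION: `E_τ × E_τ'` with `η⁻ = E_τ ⊞ (−E_τ')` -/

section Witness

variable {τ τ' : ℂ} (hτ : 0 < τ.im) (hτ' : 0 < τ'.im)

/-- `η⁻ = E_τ ⊞ (−E_τ') ∈ NS(E_τ × E_τ')` (type `(1,1)`, integral on `Λ_τ ⊕ Λ_τ'`).
[cite: Lange2023AbelianVarietiesComplex, §2.4.4 Cor. 2.4.24 and §1.3.1 (1.10)] -/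
theorem isNSForm_prodForm_elliptic_neg :
    IsNSForm (prodPeriod (ellipticPeriod hτ.ne') (ellipticPeriod hτ'.ne'))
      (prodForm (ellipticForm hτ.ne') (-ellipticForm hτ'.ne')) :=
  (isRiemannForm_ellipticForm hτ).isNSForm.prod (isRiemannForm_ellipticForm hτ').isNSForm.neg

/-- The Hermitian form `H⁻ = H_{η⁻}` on the complex basis `(1,0), (0,1)` of `ℂ × ℂ` is DIAGONAL with entries
`1/Im τ > 0` and `-1/Im τ' < 0` (`H_τ(v, w) = v w̄/Im τ` on each factor, Example 2.1.3).
[cite: Lange2023AbelianVarietiesComplex, §2.1.1 Example 2.1.3 and §1.2.2 Lemma 1.2.10] -/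
theorem hermOf_prodForm_elliptic_neg_finTwoProd (k l : Fin 2) :
    hermOf (prodForm (ellipticForm hτ.ne') (-ellipticForm hτ'.ne'))
        (Module.Basis.finTwoProd ℂ k) (Module.Basis.finTwoProd ℂ l) =
      if k = l then ((![τ.im⁻¹, -τ'.im⁻¹] k : ℝ) : ℂ) else 0 := by
  fin_cases k <;> fin_cases l <;>
    simp [hermOf_apply, prodForm_apply, ellipticForm_apply, div_eq_mul_inv]

/-- **`index(H⁻) = 1`** (Sylvester on the diagonal basis: exactly one negative entry).
[cite: Lange2023AbelianVarietiesComplex, §1.6.2 (p0066)] [cite: GohbergLancasterRodman2005, §2.3 Thm. 2.3.2] -/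
theorem hermIndex_prodForm_elliptic_neg :
    hermIndex (prodForm (ellipticForm hτ.ne') (-ellipticForm hτ'.ne')) = 1 := by
  rw [hermIndex_eq_card_of_orthogonal _ (isNSForm_prodForm_elliptic_neg hτ hτ').type_one_one
    (Module.Basis.finTwoProd ℂ) ![τ.im⁻¹, -τ'.im⁻¹]
    (fun k ↦ by fin_cases k <;> simp [hτ.ne', hτ'.ne'])
    (hermOf_prodForm_elliptic_neg_finTwoProd hτ hτ')]
  rw [Finset.card_eq_one]
  refine ⟨1, ?_⟩
  ext k
  fin_cases k <;> simp [hτ', hτ.le, inv_pos, not_lt]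

/-- `η⁻` is non-degenerate. [cite: GohbergLancasterRodman2005, §2.2] -/
theorem nondegenerate_prodForm_elliptic_neg :
    ∀ v : ℂ × ℂ, v ≠ 0 → ∃ u : ℂ × ℂ, prodForm (ellipticForm hτ.ne') (-ellipticForm hτ'.ne') ![v, u] ≠ 0 :=
  exists_apply_ne_zero_of_orthogonal _ (isNSForm_prodForm_elliptic_neg hτ hτ').type_one_one
    (Module.Basis.finTwoProd ℂ) ![τ.im⁻¹, -τ'.im⁻¹]
    (fun k ↦ by fin_cases k <;> simp [hτ.ne', hτ'.ne'])
    (hermOf_prodForm_elliptic_neg_finTwoProd hτ hτ')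

/-- The Gram matrix of `η⁻` on the concatenated lattice basis `(τ, 1; τ', 1)` is block diagonal
`((0 1; -1 0), (0 -1; 1 0))`, of determinant `1` (`= Pf(η⁻)²`, so every type of `η⁻` has `d₁d₂ = 1`).
[cite: Lange2023AbelianVarietiesComplex, §2.4.4 Cor. 2.4.24 and §2.1.1 Example 2.1.3] -/
theorem det_latticeGram_prodForm_elliptic_neg :
    (latticeGram (prodPeriod (ellipticPeriod hτ.ne') (ellipticPeriod hτ'.ne'))
      (prodForm (ellipticForm hτ.ne') (-ellipticForm hτ'.ne'))).det = 1 := by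
  have hneg : latticeGram (ellipticPeriod hτ'.ne') (-ellipticForm hτ'.ne') = -!![0, 1; -1, 0] := by
    rw [← latticeGram_elliptic hτ'.ne']
    ext i j
    rw [latticeGram_apply, Matrix.neg_apply, latticeGram_apply, ContinuousAlternatingMap.neg_apply]
  rw [latticeGram_prod, Matrix.det_fromBlocks_zero₂₁, latticeGram_elliptic, hneg, Matrix.det_neg,
    Matrix.det_fin_two_of]
  norm_num

/-- **THE VALUE: `∫_{E_τ × E_τ'} η⁻ ∧ η⁻ = -2`** (`= (-1)^{g+s}·g!·d₁d₂` with `g = 2`, `s = 1`, `d₁d₂ = 1`: the tree's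
general formula, Lange Lemma 1.7.5 + proof of Thm. 1.7.3; compare `+2` for the polarisation `E_τ ⊞ E_τ'`, tree
`torusIntegral_wedgePow_prod_elliptic`) — the smallest sibling of the sheet's `∫_{E⁴} b⁴ = -24`.
[cite: Lange2023AbelianVarietiesComplex, §1.7.2 Lemma 1.7.5 and proof of Thm. 1.7.3] -/
theorem torusIntegral_wedgePow_prodForm_elliptic_neg_eq (e : Fin (2 * 2) ≃ Fin 2 ⊕ Fin 2) :
    torusIntegral (prodPeriod (ellipticPeriod hτ.ne') (ellipticPeriod hτ'.ne')) e
        (wedgePow (ofRealForm (prodForm (ellipticForm hτ.ne') (-ellipticForm hτ'.ne'))) 2) = -2 := by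
  have hNS := isNSForm_prodForm_elliptic_neg hτ hτ'
  have hnd := nondegenerate_prodForm_elliptic_neg hτ hτ'
  obtain ⟨d, hd⟩ := exists_isPolarizationType_of_equiv _ hNS hnd e
  rw [hNS.torusIntegral_wedgePow_of_isPolarizationType _ hnd hd e, hermIndex_prodForm_elliptic_neg hτ hτ']
  have hdet := hd.det_latticeGram
  rw [det_latticeGram_prodForm_elliptic_neg hτ hτ'] at hdet
  have hnn : (0 : ℝ) ≤ ∏ i, (d i : ℝ) := Finset.prod_nonneg fun i _ ↦ Nat.cast_nonneg _
  have hprod : ∏ i, (d i : ℝ) = 1 := by nlinarith [hdet, hnn]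
  have hN : (∏ i, d i : ℕ) = 1 := by exact_mod_cast hprod
  have hC : (∏ i, (d i : ℂ)) = 1 := by exact_mod_cast hN
  rw [hC]
  norm_num [Nat.factorial]

/-- **(H1) FAILS AT EVEN DIMENSION, AT THE OBJECT LEVEL**: on the abelian surface `X = E_τ × E_τ'` (`n = 2`) the
non-degenerate class `η⁻ = E_τ ⊞ (−E_τ') ∈ NS(X)` of index `1` has **`∫_X η⁻ ∧ η⁻ < 0`** (from the value `-2`; equivalently file III's
`torusIntegral_wedgePow_neg_of_odd`, `2 + 1` odd) — the sheet's counter-model S3INP-4 (`E⁴`, `e₁+e₂+e₃−e₄`) in its smallest instance, as a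
theorem about `∫_X`. [cite: Lange2023AbelianVarietiesComplex, §1.7.2 Lemma 1.7.5 and proof of Thm. 1.7.3] -/
theorem torusIntegral_wedgePow_prodForm_elliptic_neg_neg (e : Fin (2 * 2) ≃ Fin 2 ⊕ Fin 2) :
    torusIntegral (prodPeriod (ellipticPeriod hτ.ne') (ellipticPeriod hτ'.ne')) e
        (wedgePow (ofRealForm (prodForm (ellipticForm hτ.ne') (-ellipticForm hτ'.ne'))) 2) < 0 := by
  rw [torusIntegral_wedgePow_prodForm_elliptic_neg_eq hτ hτ' e, neg_lt_zero]
  exact zero_lt_two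

/-- **S3INP-4 AT THE OBJECT LEVEL, PACKAGED**: there is an ABELIAN surface `X = E_τ × E_τ'` (a product of elliptic
curves is an abelian variety, tree `IsAbelianVariety.prod`) carrying a non-degenerate class `η⁻ ∈ NS(X)` of index `1`
with `∫_X η⁻ ∧ η⁻ = -2 < 0`: (H1) is NOT a theorem about non-degenerate `NS` classes at even dimension — its scope
«index even» (file III) is a genuine condition. [cite: Lange2023AbelianVarietiesComplex, §1.7.2 Lemma 1.7.5 and §2.1.1 Example 2.1.3] -/
theorem abelianSurface_nsForm_hermIndex_one_torusIntegral_neg (e : Fin (2 * 2) ≃ Fin 2 ⊕ Fin 2) :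
    IsAbelianVariety (prodPeriod (ellipticPeriod hτ.ne') (ellipticPeriod hτ'.ne')) ∧
      IsNSForm (prodPeriod (ellipticPeriod hτ.ne') (ellipticPeriod hτ'.ne'))
        (prodForm (ellipticForm hτ.ne') (-ellipticForm hτ'.ne')) ∧
      (∀ v : ℂ × ℂ, v ≠ 0 → ∃ u : ℂ × ℂ, prodForm (ellipticForm hτ.ne') (-ellipticForm hτ'.ne') ![v, u] ≠ 0) ∧
      hermIndex (prodForm (ellipticForm hτ.ne') (-ellipticForm hτ'.ne')) = 1 ∧
      torusIntegral (prodPeriod (ellipticPeriod hτ.ne') (ellipticPeriod hτ'.ne')) e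
        (wedgePow (ofRealForm (prodForm (ellipticForm hτ.ne') (-ellipticForm hτ'.ne'))) 2) = -2 :=
  ⟨(isAbelianVariety_elliptic hτ).prod (isAbelianVariety_elliptic hτ'), isNSForm_prodForm_elliptic_neg hτ hτ',
    nondegenerate_prodForm_elliptic_neg hτ hτ', hermIndex_prodForm_elliptic_neg hτ hτ',
    torusIntegral_wedgePow_prodForm_elliptic_neg_eq hτ hτ' e⟩

/-- **NO LEMMA-PROFILE `G`-OBJECT WITH SECANT DIRECTION `η⁻` ON `E_τ × E_τ'`**: at `n = 2` (`m = 1` odd) a class of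
ODD index admits NO χ-identity `(2w(-4d)/2!)·∫_X η⁻∧η⁻ = G·(-2)` with `d, w, G > 0` (§2's other branch puts the
obstruction for odd index at `n ≡ 2 (mod 4)`; directly: the left side is `+8wd > 0`).
[cite: Lange2023AbelianVarietiesComplex, §1.7.2 Lemma 1.7.5 and proof of Thm. 1.7.3] -/
theorem not_chi_identity_prodForm_elliptic_neg (e : Fin (2 * (2 * 1)) ≃ Fin 2 ⊕ Fin 2) {d w G : ℝ}
    (hd : 0 < d) (hw : 0 < w) (hG : 0 < G) :
    (2 * (w : ℂ) * (-4 * (d : ℂ)) ^ 1 / ((2 * 1).factorial : ℂ)) *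
        torusIntegral (prodPeriod (ellipticPeriod hτ.ne') (ellipticPeriod hτ'.ne')) e
          (wedgePow (ofRealForm (prodForm (ellipticForm hτ.ne') (-ellipticForm hτ'.ne'))) (2 * 1)) ≠
      (G : ℂ) * (-2) := by
  intro h
  have h1 := (even_and_four_dvd_of_chi_identity_of_odd_hermIndex _ (isNSForm_prodForm_elliptic_neg hτ hτ')
    (nondegenerate_prodForm_elliptic_neg hτ hτ') e hd hw hG h
    (by rw [hermIndex_prodForm_elliptic_neg hτ hτ']; exact odd_one)).1
  exact Nat.not_even_one h1

end Witness

end SecantParity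

end Summit.Ventures.HSemireg
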